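/-
Copyright (c) 2026. All rights reserved.
Released under Apache 2.0 license as described in the file LICENSE.
Authors: abc-iut cell, seat abc-iut-w5-d019 (gen 8).
-/
import Literature.NumberTheory.GaloisRepresentations.LocalGaloisSolvable
import Literature.GroupTheory.CommutatorWidthNilpotentByMetacyclic
import Literature.GroupTheory.NormalGeneratorsOfMetacyclicQuotient
import Literature.NumberTheory.GaloisRepresentations.AbsGaloisGroupCompact
import Mathlib.FieldTheory.Galois.Profinite
import Mathlib.RingTheory.IntegralDomain
import HarnessLib

/-!
# The Galois group of a finite Galois extension of a non-archimedean local field has commutator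
# width bounded by its number of generators; the derived subgroup of `Γ_F` is closed

J.-P. Serre, *Corps locaux*, Ch. IV §2 (Cor. 1, 3, 5 of Prop. 7): for a finite Galois extension `E/F`
of a non-archimedean local field, `G₁ ⊴ G₀ ⊴ Gal(E/F)` with `G₁` a `p`-group, `G₀/G₁ ↪ κ_E^×` cyclic
and `Gal/G₀ ↪ Gal(κ_E/κ_F)` cyclic — the inputs already assembled in `LocalGaloisSolvable.lean`
(`isSolvable_of_stabilizer_eq_top`).  Feeding them into the Hartley-type width theorems of
`Literature/GroupTheory/` (`NilpotentByMetacyclicWidth.commutator_subset_powProd`,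
`MetacyclicNormalGenerators.exists_normalGenerators`) instead of "solvable" gives:

* `commutator_subset_powProd_of_stabilizer_eq_top` — Dedekind level: a finite group `G` acting
  faithfully on a Dedekind domain, fixing a maximal ideal `𝔓 ≠ 0` with finite residue field, and
  generated by the entries of a list `l`, has every element of `[G, G]` a product of
  `2·l.length + 5` commutators;
* `commutator_subset_powProd_algEquiv_intermediateField` — the same for `Gal(E/F)`, `E/F` a finite
  Galois subextension of `F̄` of a non-archimedean local field `F`;
* `commutator_quotient_subset_powProd_of_dense` — hence for every open normal `U ≤ Γ_F`, every
  element of `[Γ_F ⧸ U, Γ_F ⧸ U]` is a product of `2m + 5` commutators, `m` the size of any finite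
  set topologically generating `Γ_F`;
* `isClosed_commutator_absoluteGaloisGroup_of_dense` — **the abstract derived subgroup of
  `Γ_F = Gal(F̄/F)` is closed** for `Γ_F` topologically finitely generated
  (`BoundedCommutatorWidth.isClosed_commutator_of_forall_quotient`).

Consumer (cell abc-iut, GAP-LEDGER G-L3d2g2-1): hypothesis "`⁅H, H⁆` closed for every open `H`" of
`StronglyCompleteOfDerivedLayers.isOpen_of_finiteIndex_of_commutator_closed` at `Γ_k`, `k/ℚ_p`
finite.  Classical local ramification theory; no definition, no instance; nothing here bears on
[IUTchIII] Cor. 3.12 or asserts anything about abc.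

[cite: SerreLocalFields1979, Ch. IV §2 Cor. 5 of Prop. 7]
-/

noncomputable section

open scoped Pointwise Valued commutatorElement
open ValuativeRel Field

namespace Literature.NumberTheory.GaloisRepresentations

/-! ### Group theory: cyclic quotients in the shape used by the width theorems -/

section GroupTheory

variable {G : Type*} [Group G]

/-- A homomorphism with cyclic range: `ker f ⊔ ⟨s⟩ = ⊤` for some `s`.
[cite: SerreLocalFields1979, Ch. IV §2 Cor. 5 of Prop. 7] -/
theorem exists_ker_sup_zpowers_eq_top {C : Type*} [Group C] (f : G →* C) [IsCyclic f.range] :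
    ∃ s : G, f.ker ⊔ Subgroup.zpowers s = ⊤ := by
  obtain ⟨γ, hγ⟩ := IsCyclic.exists_generator (α := f.range)
  obtain ⟨s, hs⟩ := γ.2
  refine ⟨s, eq_top_iff.mpr fun g _ => ?_⟩
  obtain ⟨k, hk⟩ := Subgroup.mem_zpowers_iff.mp (hγ ⟨f g, ⟨g, rfl⟩⟩)
  have hk' : f (s ^ k) = f g := by
    have := congrArg Subtype.val hk
    simp only [SubgroupClass.coe_zpow] at this
    rw [map_zpow, hs]
    exact this
  have hker : g * (s ^ k)⁻¹ ∈ f.ker := by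
    rw [MonoidHom.mem_ker, map_mul, map_inv, hk', mul_inv_cancel]
  exact Subgroup.mem_sup_of_normal_left.mpr ⟨g * (s ^ k)⁻¹, hker, s ^ k,
    Subgroup.zpow_mem _ (Subgroup.mem_zpowers s) k, inv_mul_cancel_right g (s ^ k)⟩

/-- A homomorphism on `↥A` with cyclic range and "kernel `N`": `A ≤ N ⊔ ⟨t⟩` for some `t ∈ A`.
[cite: SerreLocalFields1979, Ch. IV §2 Cor. 5 of Prop. 7] -/
theorem exists_le_sup_zpowers_of_hom {C : Type*} [Group C] {A N : Subgroup G} (θ : A →* C)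
    [IsCyclic θ.range] (hθ : ∀ σ : A, θ σ = 1 ↔ (σ : G) ∈ N) :
    ∃ t ∈ A, A ≤ N ⊔ Subgroup.zpowers t := by
  obtain ⟨s, hs⟩ := exists_ker_sup_zpowers_eq_top θ
  refine ⟨(s : G), s.2, fun a ha => ?_⟩
  have hmem : (⟨a, ha⟩ : A) ∈ θ.ker ⊔ Subgroup.zpowers s := by rw [hs]; exact Subgroup.mem_top _
  obtain ⟨x, hx, y, hy, hxy⟩ := Subgroup.mem_sup_of_normal_left.mp hmem
  obtain ⟨k, rfl⟩ := Subgroup.mem_zpowers_iff.mp hy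
  have hxN : (x : G) ∈ N := (hθ x).mp (MonoidHom.mem_ker.mp hx)
  have ha' : a = (x : G) * (s : G) ^ k := by
    have := congrArg Subtype.val hxy
    simpa using this.symm
  rw [ha']
  exact Subgroup.mul_mem _ (Subgroup.mem_sup_left hxN)
    (Subgroup.mem_sup_right (Subgroup.zpow_mem _ (Subgroup.mem_zpowers _) k))

end GroupTheory

/-! ### Dedekind level: `G₁ ⊲ G₀ ⊲ D_𝔓` -/

section Dedekind

variable {S : Type*} [CommRing S] [IsDedekindDomain S] (𝔓 : Ideal S) (G : Type*) [Group G]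
  [MulSemiringAction G S] [Finite G] [FaithfulSMul G S]

/-- **Commutator width of decomposition groups (Dedekind level).**  Let a finite group `G`,
generated by the entries of `l`, act faithfully on a Dedekind domain `S` fixing a maximal ideal
`𝔓 ≠ 0` with finite residue field.  Then every element of `[G, G]` is a product of
`2·l.length + 5` commutators: `G₁ = 𝔓.ramificationSubgroup G 1` is a `p`-group (nilpotent), `G₀/G₁`
(tame character into `(S/𝔓)ˣ`) and `G/G₀` (into `Gal((S/𝔓)/𝔽_p)`) are cyclic, `G₁` is the normal
closure of `l.length + 4` elements, and the nilpotent-by-metacyclic width theorem applies.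
[cite: SerreLocalFields1979, Ch. IV §2 Cor. 5 of Prop. 7] -/
theorem commutator_subset_powProd_of_stabilizer_eq_top [𝔓.IsMaximal] [Finite (S ⧸ 𝔓)]
    (h0 : 𝔓 ≠ ⊥) (htop : MulAction.stabilizer G 𝔓 = ⊤) {l : List G}
    (hl : Subgroup.closure {a : G | a ∈ l} = ⊤) :
    (commutator G : Set G) ⊆
      (List.replicate (2 * l.length + 5) {c : G | ∃ x y : G, ⁅x, y⁆ = c}).prod := by
  classical
  obtain ⟨p, hp, _, hpmem⟩ := exists_prime_charP_quotient 𝔓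
  haveI : Fact p.Prime := ⟨hp⟩
  have hdec : ∀ τ : G, τ ∈ 𝔓.decompositionSubgroup G := fun τ => by
    change τ ∈ MulAction.stabilizer G 𝔓
    rw [htop]; exact Subgroup.mem_top τ
  -- `N = G₁`, `A = G₀`, both normal (the decomposition group is everything)
  haveI hNn : (𝔓.ramificationSubgroup G 1).Normal :=
    ⟨fun σ hσ τ => Ideal.ramificationSubgroup_conj_mem 𝔓 G hσ (hdec τ)⟩
  haveI hAn : (𝔓.inertia G).Normal := by
    rw [← Ideal.ramificationSubgroup_zero 𝔓 G]
    exact ⟨fun σ hσ τ => Ideal.ramificationSubgroup_conj_mem 𝔓 G hσ (hdec τ)⟩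
  have hNA : 𝔓.ramificationSubgroup G 1 ≤ 𝔓.inertia G := Ideal.ramificationSubgroup_le_inertia 𝔓 G 1
  -- `G₁` is a `p`-group, hence nilpotent
  have hG1 : IsPGroup p (𝔓.ramificationSubgroup G 1) :=
    Ideal.isPGroup_ramificationSubgroup_one 𝔓 G (Ideal.IsMaximal.ne_top inferInstance) hpmem
  haveI : Group.IsNilpotent (𝔓.ramificationSubgroup G 1) := hG1.isNilpotent
  -- `G₀/G₁` cyclic: the tame character
  obtain ⟨θ, hθ⟩ := exists_inertia_hom_units_ker_eq 𝔓 G h0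
  letI : Field (S ⧸ 𝔓) := Ideal.Quotient.field 𝔓
  haveI : IsCyclic θ.range := by
    refine isCyclic_of_injective_ringHom (R := S ⧸ 𝔓)
      ((Units.coeHom (S ⧸ 𝔓)).comp θ.range.subtype) ?_
    intro a b h
    exact Subtype.ext (Units.ext h)
  obtain ⟨t, ht, hAt⟩ := exists_le_sup_zpowers_of_hom θ hθ
  -- `G/G₀` cyclic: the residue Galois group
  set pZ : Ideal ℤ := 𝔓.under ℤ with hpZ
  have hinj : Function.Injective (algebraMap (ℤ ⧸ pZ) (S ⧸ 𝔓)) :=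
    (faithfulSMul_iff_algebraMap_injective (ℤ ⧸ pZ) (S ⧸ 𝔓)).mp inferInstance
  haveI : Finite (ℤ ⧸ pZ) := Finite.of_injective _ hinj
  haveI : IsDomain (ℤ ⧸ pZ) := hinj.isDomain _
  haveI hpmax : pZ.IsMaximal :=
    Ideal.Quotient.maximal_of_isField pZ (Finite.isField_of_domain (ℤ ⧸ pZ))
  letI : Field (ℤ ⧸ pZ) := Ideal.Quotient.field pZ
  let φ : ↥(MulAction.stabilizer G 𝔓) →* ((S ⧸ 𝔓) ≃ₐ[ℤ ⧸ pZ] (S ⧸ 𝔓)) :=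
    Ideal.Quotient.stabilizerHom 𝔓 pZ G
  have hφ : φ.ker = 𝔓.inertia ↥(MulAction.stabilizer G 𝔓) := Ideal.Quotient.ker_stabilizerHom 𝔓 pZ G
  haveI : IsCyclic ((S ⧸ 𝔓) ≃ₐ[ℤ ⧸ pZ] (S ⧸ 𝔓)) := inferInstance
  haveI : IsCyclic φ.range := Subgroup.isCyclic _
  obtain ⟨s', hs'⟩ := exists_ker_sup_zpowers_eq_top φ
  have hinert : 𝔓.inertia ↥(MulAction.stabilizer G 𝔓) =
      (𝔓.inertia G).subgroupOf (MulAction.stabilizer G 𝔓) :=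
    (AddSubgroup.subgroupOf_inertia (𝔓.toAddSubgroup) (MulAction.stabilizer G 𝔓)).symm
  have hs : 𝔓.inertia G ⊔ Subgroup.zpowers (s' : G) = ⊤ := by
    have h := congrArg (Subgroup.map (MulAction.stabilizer G 𝔓).subtype) hs'
    rw [Subgroup.map_sup, hφ, hinert, Subgroup.subgroupOf_map_subtype,
      MonoidHom.map_zpowers, ← MonoidHom.range_eq_map, Subgroup.range_subtype,
      inf_eq_left.mpr (Ideal.inertia_le_stabilizer 𝔓), Subgroup.subtype_apply] at h
    exact h.trans htop
  -- `G₁` is the normal closure of `l.length + 4` elements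
  obtain ⟨v, hvlen, hvN, hNv⟩ := Literature.GroupTheory.MetacyclicNormalGenerators.exists_normalGenerators
    (𝔓.ramificationSubgroup G 1) (𝔓.inertia G) hNA ht hAt hs hl
  -- the width theorem
  have hA := Literature.GroupTheory.NilpotentByMetacyclicWidth.commutator_le_commutator_top_of_le_sup_zpowers
    (𝔓.ramificationSubgroup G 1) (𝔓.inertia G) hAt
  have hw := Literature.GroupTheory.NilpotentByMetacyclicWidth.commutator_subset_powProd
    (𝔓.ramificationSubgroup G 1) (𝔓.inertia G) hA hs hl hvN hNv
  have hlen : (l ++ v).length + 1 = 2 * l.length + 5 := by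
    rw [List.length_append, hvlen]; ring
  rw [← hlen]
  exact hw

end Dedekind

/-! ### Local fields -/

section LocalField

open GaloisRepresentations.IsNonarchimedeanLocalField

variable (F : Type*) [Field F] [ValuativeRel F] [TopologicalSpace F] [IsNonarchimedeanLocalField F]

/-- **Commutator width of `Gal(E/F)`** for a finite Galois subextension `E/F` of `F̄`, `F` a
non-archimedean local field: if `Gal(E/F)` is generated by the entries of `l`, every element of its
derived group is a product of `2·l.length + 5` commutators (`Gal(E/F)` acts faithfully on `O_E`
fixing `𝔓_E`; Dedekind level). [cite: SerreLocalFields1979, Ch. IV §2 Cor. 5 of Prop. 7] -/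
theorem commutator_subset_powProd_algEquiv_intermediateField
    (E : IntermediateField F (AlgebraicClosure F)) [FiniteDimensional F E] [IsGalois F E]
    {l : List (E ≃ₐ[F] E)} (hl : Subgroup.closure {a : E ≃ₐ[F] E | a ∈ l} = ⊤) :
    (commutator (E ≃ₐ[F] E) : Set (E ≃ₐ[F] E)) ⊆
      (List.replicate (2 * l.length + 5) {c : E ≃ₐ[F] E | ∃ x y : E ≃ₐ[F] E, ⁅x, y⁆ = c}).prod := by
  haveI := faithfulSMul_algEquiv_integralClosure_intermediateField F E
  haveI : IsDedekindDomain (integralClosure 𝒪[F] E) := integralClosure.isDedekindDomain 𝒪[F] F E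
  haveI : (absMaximalIdeal F).IsMaximal := absMaximalIdeal_isMaximal_holds F
  haveI := isMaximal_comap_integralClosureToAbsIntegers 𝒪[F] (absMaximalIdeal F) E
  haveI := finite_integralClosure_quotient F E
  refine commutator_subset_powProd_of_stabilizer_eq_top
    ((absMaximalIdeal F).comap (E.integralClosureToAbsIntegers 𝒪[F])) (E ≃ₐ[F] E)
    (comap_absMaximalIdeal_ne_bot F E) ?_ hl
  rw [eq_top_iff]
  intro g _
  exact smul_comap_absMaximalIdeal F E g

omit [ValuativeRel F] [TopologicalSpace F] [IsNonarchimedeanLocalField F] in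
/-- A finite set topologically generating `Γ_F` maps onto a generating set of every `Gal(E/F)`,
`E/F ⊆ F̄` finite normal (restriction is continuous, `Gal(E/F)` is discrete, and a dense subgroup of a
discrete group is everything). [cite: SerreLocalFields1979, Ch. IV §2 Cor. 5 of Prop. 7] -/
theorem closure_map_absRestrictNormalHom_eq_top_of_dense
    (E : IntermediateField F (AlgebraicClosure F)) [FiniteDimensional F E] [Normal F E]
    {T : Finset (absoluteGaloisGroup F)}
    (hT : Dense ((Subgroup.closure (T : Set (absoluteGaloisGroup F)) :
      Subgroup (absoluteGaloisGroup F)) : Set (absoluteGaloisGroup F))) :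
    Subgroup.closure {a : E ≃ₐ[F] E | a ∈ (T.toList.map (absRestrictNormalHom (K := F) E))} = ⊤ := by
  classical
  have hsurj : Function.Surjective (absRestrictNormalHom (K := F) E) :=
    (AlgEquiv.restrictNormalHom_surjective (F := F) (K₁ := E) (AlgebraicClosure F)).comp
      (absoluteGaloisGroup.toAlgEquiv F).surjective
  have hcont : Continuous (absRestrictNormalHom (K := F) E) :=
    (InfiniteGalois.restrictNormalHom_continuous E).comp continuous_id
  -- the image of the dense subgroup is dense in the discrete group `Gal(E/F)`, hence everything
  have hdense : Dense ((absRestrictNormalHom (K := F) E) ''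
      ((Subgroup.closure (T : Set (absoluteGaloisGroup F)) : Subgroup (absoluteGaloisGroup F)) :
        Set (absoluteGaloisGroup F))) :=
    hsurj.denseRange.dense_image hcont hT
  have heq : {a : E ≃ₐ[F] E | a ∈ (T.toList.map (absRestrictNormalHom (K := F) E))} =
      (absRestrictNormalHom (K := F) E) '' (T : Set (absoluteGaloisGroup F)) := by
    ext a
    simp [Finset.mem_toList]
  rw [heq, ← MonoidHom.map_closure, eq_top_iff]
  intro g _
  have hg : g ∈ closure ((absRestrictNormalHom (K := F) E) ''
      ((Subgroup.closure (T : Set (absoluteGaloisGroup F)) : Subgroup (absoluteGaloisGroup F)) :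
        Set (absoluteGaloisGroup F))) := by
    rw [hdense.closure_eq]; exact Set.mem_univ g
  rw [(isClosed_discrete _).closure_eq] at hg
  rw [← Subgroup.coe_map] at hg
  exact hg

/-- **Uniform commutator width of the finite quotients of `Γ_F`.**  If the finite set `T`
topologically generates `Γ_F = Gal(F̄/F)` (`F` a non-archimedean local field), then for every open
normal subgroup `U`, every element of `[Γ_F ⧸ U, Γ_F ⧸ U]` is a product of `2·|T| + 5` commutators.
[cite: SerreLocalFields1979, Ch. IV §2 Cor. 5 of Prop. 7] -/
theorem commutator_quotient_subset_powProd_of_dense {T : Finset (absoluteGaloisGroup F)}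
    (hT : Dense ((Subgroup.closure (T : Set (absoluteGaloisGroup F)) :
      Subgroup (absoluteGaloisGroup F)) : Set (absoluteGaloisGroup F)))
    (U : OpenNormalSubgroup (absoluteGaloisGroup F)) :
    (commutator (absoluteGaloisGroup F ⧸ (U : Subgroup (absoluteGaloisGroup F))) :
        Set (absoluteGaloisGroup F ⧸ (U : Subgroup (absoluteGaloisGroup F)))) ⊆
      (List.replicate (2 * T.toList.length + 5)
        {c : absoluteGaloisGroup F ⧸ (U : Subgroup (absoluteGaloisGroup F)) |
          ∃ x y : absoluteGaloisGroup F ⧸ (U : Subgroup (absoluteGaloisGroup F)), ⁅x, y⁆ = c}).prod := by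
  classical
  haveI : DiscreteTopology (absoluteGaloisGroup F ⧸ (U : Subgroup (absoluteGaloisGroup F))) :=
    QuotientGroup.discreteTopology U.isOpen
  let f : absoluteGaloisGroup F →ₜ* absoluteGaloisGroup F ⧸ (U : Subgroup (absoluteGaloisGroup F)) :=
    ⟨QuotientGroup.mk' (U : Subgroup (absoluteGaloisGroup F)), QuotientGroup.continuous_mk⟩
  obtain ⟨E, hfd, hgal, hker⟩ := exists_isGalois_ker_le F f
  have hker' : (absRestrictNormalHom (K := F) E).ker ≤ (U : Subgroup (absoluteGaloisGroup F)) := by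
    refine hker.trans (le_of_eq ?_)
    exact QuotientGroup.ker_mk' _
  -- the width bound in `Gal(E/F)` for the images of `T`
  have hw := commutator_subset_powProd_algEquiv_intermediateField F E
    (closure_map_absRestrictNormalHom_eq_top_of_dense F E hT)
  rw [List.length_map] at hw
  -- `Γ_F ⧸ U` is the quotient of `Gal(E/F) ≃ Γ_F ⧸ ker` by the image of `U`
  have hsurjE : Function.Surjective (absRestrictNormalHom (K := F) E) :=
    (AlgEquiv.restrictNormalHom_surjective (F := F) (K₁ := E) (AlgebraicClosure F)).comp
      (absoluteGaloisGroup.toAlgEquiv F).surjective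
  let e := QuotientGroup.quotientKerEquivOfSurjective _ hsurjE
  let q : absoluteGaloisGroup F ⧸ (absRestrictNormalHom (K := F) E).ker →*
      absoluteGaloisGroup F ⧸ (U : Subgroup (absoluteGaloisGroup F)) :=
    QuotientGroup.map _ _ (MonoidHom.id _) hker'
  have hq : Function.Surjective q := by
    intro x
    obtain ⟨σ, rfl⟩ := QuotientGroup.mk_surjective x
    exact ⟨QuotientGroup.mk σ, rfl⟩
  have hg : Function.Surjective (q.comp e.symm.toMonoidHom) := hq.comp e.symm.surjective
  -- transport the width bound along the surjection `Gal(E/F) → Γ_F ⧸ U`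
  intro c hc
  have hcomm : commutator (absoluteGaloisGroup F ⧸ (U : Subgroup (absoluteGaloisGroup F))) =
      (commutator (E ≃ₐ[F] E)).map (q.comp e.symm.toMonoidHom) := by
    rw [commutator, commutator, Subgroup.map_commutator, ← MonoidHom.range_eq_map,
      MonoidHom.range_eq_top.mpr hg]
  rw [hcomm, Subgroup.coe_map] at hc
  obtain ⟨c', hc', rfl⟩ := hc
  rw [← Literature.GroupTheory.BoundedCommutatorWidth.image_powProd (q.comp e.symm.toMonoidHom) hg]
  exact Set.mem_image_of_mem _ (hw hc')

/-- **The derived subgroup of `Γ_F` is closed** for `F` a non-archimedean local field with `Γ_F`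
topologically finitely generated (e.g. `F` of characteristic `0`, [NSW] Thm 7.5.10; tree:
`MLFGaloisTFG`): uniform commutator width in the finite quotients
(`commutator_quotient_subset_powProd_of_dense`) and compactness
(`BoundedCommutatorWidth.isClosed_commutator_of_forall_quotient`).
[cite: SerreLocalFields1979, Ch. IV §2 Cor. 5 of Prop. 7] -/
theorem isClosed_commutator_absoluteGaloisGroup_of_dense {T : Finset (absoluteGaloisGroup F)}
    (hT : Dense ((Subgroup.closure (T : Set (absoluteGaloisGroup F)) :
      Subgroup (absoluteGaloisGroup F)) : Set (absoluteGaloisGroup F))) :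
    IsClosed ((commutator (absoluteGaloisGroup F) : Subgroup (absoluteGaloisGroup F)) :
      Set (absoluteGaloisGroup F)) := by
  haveI : CompactSpace (absoluteGaloisGroup F) := absoluteGaloisGroup_compactSpace F
  exact Literature.GroupTheory.BoundedCommutatorWidth.isClosed_commutator_of_forall_quotient
    (commutator_quotient_subset_powProd_of_dense F hT)

end LocalField

end Literature.NumberTheory.GaloisRepresentations

end
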